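import Summits.ABC.StewartYu.GenThreeEndExits
import HarnessLib

/-!
# Cell abc-stewartyu, WP-L.P shell S1 (parity-free): the END with exits at REAL points `(x, ξˣ)`,
# `ξⱼ = αⱼ^{c}` a real power of positive independent rationals (Nesterenko's `ξⱼ = αⱼ^{1/N}`)

`Summits/ABC/StewartYu/GenThreeEndReal.lean` — cell `abc-stewartyu` (HOME `run/shared/lean/pub/abc-stewartyu/`),
seat p3 (designed g8, filed g9 on the A1.L tranche GO, HUMAN D-0137 2026-08-27), parity-free SHELL layer S1 of
the 𝔑-threaded (Kummer-free) Gen-3 frames of route `YuMatveevShapeRat` (HOME/p3/memo-11 §3 S1; HOME/p2/memo-07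
§1 (L4), §2 row «shells»: `GenThreeEndReal`).  Theorems + one auxiliary `def` (`rpowUnit`).

The 𝔑-threaded frames apply the zero estimate `Nesterenko2003_prop51` (over `ℂ`, any finite point set) at the
points `(x, ξ₁ˣ, …, ξₙˣ)` with `ξⱼ = αⱼ^{1/N}` REAL (Nesterenko 2003 §5.1 (5.3)–(5.4): the polynomial
`P(Y) = Y^{−Nv}·𝒢(Y₀, Y^N)` has integer exponents, its zeros are at the `N`-th roots).  The landed END
(`GenThreeVanishingPoints/Orbit/Shift`, p3-g4) is already generic in `ξ : Fin m → ℂˣ`; only the last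
transport (`GenThreeVanishingRat`/`GenThreeEndRat`/`GenThreeEndExits.exists_exits_rat`, rational `α`) is
`ℚ`-specific.  This file gives (1) `exists_exits_units` — the exits for ANY complex units `ξ` multiplicatively
independent over `ℤ` (H kept, exit A / exit B–C, verbatim the conclusion of `exists_exits_rat`), and (2) the
independence transport `hind_units_of_rpow`: for positive reals `aⱼ` with `∏ aⱼ^{μⱼ} = 1 ⇒ μ = 0` and a real
exponent `c ≠ 0`, the units `ξⱼ := (aⱼ^c : ℂ)` are independent (logarithms), with the rational special case
`hind_units_of_rpow_rat` (`aⱼ = αⱼ ∈ ℚ_{>0}`).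

WHAT THIS IS NOT: no frame; no record; nothing about the rung (support library only; A1.L not moved).

References: Yu. V. Nesterenko, LNM 1819 (2003), §5.1 (5.3)–(5.4), §5.2 Prop 5.1, Lemmas 5.2–5.3;
HOME/p2/memo-07 §1 (L4); HOME/p3/memo-11 §1 (M4).
-/

noncomputable section

open Finset
open Literature.NumberTheory.Transcendental
open Literature.NumberTheory.Transcendental.GaGm

namespace Summit.ABC.StewartYu.GenThreeEndReal

variable {m : ℕ}

/-! ### Independence of real powers of independent positive reals, as complex units -/

/-- The complex unit attached to a positive real base `a` and a real exponent `c`: `(a^c : ℂ)`.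
[folklore] -/
def rpowUnit (a : ℝ) (ha : 0 < a) (c : ℝ) : ℂˣ :=
  Units.mk0 (((a ^ c : ℝ)) : ℂ) (by exact_mod_cast (Real.rpow_pos_of_pos ha c).ne')

/-- The value of `rpowUnit a ha c` is `((a^c : ℝ) : ℂ)`. [folklore] -/
@[simp] theorem val_rpowUnit (a : ℝ) (ha : 0 < a) (c : ℝ) :
    ((rpowUnit a ha c : ℂˣ) : ℂ) = (((a ^ c : ℝ)) : ℂ) := rfl

/-- **Independence transports through real powers**: if the positive reals `aⱼ` are multiplicatively
independent over `ℤ` and `c ≠ 0`, so are the complex units `(aⱼ^c : ℂ)` (take logarithms: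
`∑ φⱼ·c·log aⱼ = 0`). [folklore] -/
theorem hind_units_of_rpow (a : Fin m → ℝ) (ha : ∀ j, 0 < a j)
    (hind : ∀ μ : Fin m → ℤ, ∏ j, a j ^ μ j = 1 → μ = 0) {c : ℝ} (hc : c ≠ 0) :
    ∀ φ : Fin m → ℤ, ∏ j, rpowUnit (a j) (ha j) c ^ φ j = 1 → φ = 0 := by
  intro φ h
  -- down to `ℝ`
  have h1 : ((∏ j, rpowUnit (a j) (ha j) c ^ φ j : ℂˣ) : ℂ) = 1 := by rw [h]; rfl
  rw [Units.coe_prod] at h1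
  simp only [Units.val_zpow_eq_zpow_val, val_rpowUnit] at h1
  have h2 : (((∏ j, (a j ^ c) ^ φ j : ℝ)) : ℂ) = 1 := by push_cast at h1 ⊢; exact h1
  have h3 : ∏ j, (a j ^ c) ^ φ j = (1 : ℝ) := by exact_mod_cast h2
  -- logarithms
  have hpos : ∀ j, 0 < a j ^ c := fun j => Real.rpow_pos_of_pos (ha j) c
  have h4 : ∑ j, (φ j : ℝ) * (c * Real.log (a j)) = 0 := by
    have hl := congrArg Real.log h3
    rw [Real.log_one, Real.log_prod (s := Finset.univ) (fun j _ => (zpow_pos (hpos j) _).ne')] at hl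
    simpa only [Real.log_zpow, Real.log_rpow (ha _)] using hl
  have h5 : ∑ j, (φ j : ℝ) * Real.log (a j) = 0 := by
    have : c * ∑ j, (φ j : ℝ) * Real.log (a j) = 0 := by
      rw [Finset.mul_sum]
      calc ∑ j, c * ((φ j : ℝ) * Real.log (a j)) = ∑ j, (φ j : ℝ) * (c * Real.log (a j)) :=
            Finset.sum_congr rfl fun j _ => by ring
        _ = 0 := h4
    rcases mul_eq_zero.mp this with h | h
    · exact absurd h hc
    · exact h
  -- back to the product `∏ aⱼ^{φⱼ} = 1`
  have h6 : Real.log (∏ j, a j ^ φ j) = 0 := by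
    rw [Real.log_prod (s := Finset.univ) (fun j _ => (zpow_pos (ha j) _).ne')]
    simpa only [Real.log_zpow] using h5
  have hprodpos : 0 < ∏ j, a j ^ φ j := Finset.prod_pos fun j _ => zpow_pos (ha j) _
  have h7 : ∏ j, a j ^ φ j = 1 := by
    rcases Real.log_eq_zero.mp h6 with h | h | h
    · exact absurd h hprodpos.ne'
    · exact h
    · linarith
  exact hind φ h7

/-- The rational special case: positive, multiplicatively independent rationals `αⱼ` give independent complex
units `((αⱼ : ℝ)^c : ℂ)` for every real `c ≠ 0` (e.g. `c = 1/N`, Nesterenko's `ξⱼ = αⱼ^{1/N}`). [folklore] -/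
theorem hind_units_of_rpow_rat (α : Fin m → ℚ) (hα : ∀ j, 0 < α j)
    (hind : ∀ μ : Fin m → ℤ, ∏ j, α j ^ μ j = 1 → μ = 0) {c : ℝ} (hc : c ≠ 0) :
    ∀ φ : Fin m → ℤ,
      ∏ j, rpowUnit ((α j : ℝ)) (by exact_mod_cast hα j) c ^ φ j = 1 → φ = 0 := by
  refine hind_units_of_rpow (fun j => ((α j : ℝ))) (fun j => by exact_mod_cast hα j) ?_ hc
  intro μ hμ
  apply hind μ
  have : (((∏ j, α j ^ μ j : ℚ)) : ℝ) = 1 := by push_cast; exact hμ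
  exact_mod_cast this

/-! ### The END with exits for arbitrary independent complex units -/

/-- **The END call for independent complex units** (the `ξ`-form of
`GenThreeVanishing.exists_obstruction_rat`): Laurent identities (5.4) at the points `(x, ξˣ)`,
`|x| ≤ (m+1)X`, to order `(m+1)S₀` in the direction space `W ⊆ {∑ bⱼ ηⱼ = 0}`, one nonzero coefficient
⇒ an obstruction `H, r, M` with the counted inequality of Prop 5.1 (orbit count `2X+1` by independence).
[cite: Nesterenko2003, §5.2 (5.13)] -/
theorem exists_obstruction_units (hZ : Nesterenko2003_prop51)
    (ξ : Fin m → ℂˣ) (hind : ∀ φ : Fin m → ℤ, ∏ j, ξ j ^ φ j = 1 → φ = 0)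
    (b : Fin m → ℤ) (j₀ : Fin m) (hb : b j₀ ≠ 0)
    (W : Submodule ℂ (ℂ × (Fin m → ℂ))) (hWb : ∀ u ∈ W, ∑ j, (b j : ℂ) * u.2 j = 0)
    {ι : Type*} (I : Finset ι) (a : ι → ℕ) (κ : ι → Fin m → ℤ) (q : ι → ℂ)
    (D₀ S₀ X : ℕ) (D : Fin m → ℕ)
    (ha : ∀ i ∈ I, a i ≤ D₀) (hκ : ∀ i ∈ I, ∀ j, |κ i j| ≤ (D j : ℤ))
    (hinj : Set.InjOn (fun i => (a i, κ i)) I) {i₀ : ι} (hi₀ : i₀ ∈ I) (hq : q i₀ ≠ 0)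
    (hL : ∀ x : ℤ, |x| ≤ (((m + 1) * X : ℕ) : ℤ) → ∀ (t : ℕ) (ν : Fin m → ℕ), ν j₀ = 0 →
      t + ∑ k, ν k ≤ (m + 1) * S₀ →
      ∑ i ∈ I, q i * (((a i).descFactorial t : ℕ) : ℂ) * ((x : ℂ) * 1) ^ (a i - t) *
        (∏ k, ((b j₀ : ℂ) * (κ i k : ℂ) - (b k : ℂ) * (κ i j₀ : ℂ)) ^ ν k) *
        ∏ j, ((ξ j : ℂ)) ^ (x * κ i j) = 0) :
    ∃ (H : ConnAlgSubgroup m) (r : ℕ) (M : Matrix (Fin r) (Fin m) ℤ),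
      r ≤ m ∧ H.addDim ≤ 1 ∧
      LinearIndependent ℤ (fun i => M i) ∧
      H.chars = AddSubgroup.closure (Set.range fun i => M i) ∧
      H.addDim + (m - r) ≤ m ∧
      Nat.choose (S₀ + (Module.finrank ℂ W - Module.finrank ℂ ↥(W ⊓ H.tangent)))
          (Module.finrank ℂ W - Module.finrank ℂ ↥(W ⊓ H.tangent)) * (2 * X + 1) *
        nesterenkoH m r H.addDim M D₀ D ≤ (m + 1).factorial * 2 ^ m * D₀ * ∏ j, D j := by
  obtain ⟨H, r, M, hM, hchars, hdim, hineq⟩ :=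
    GenThreeVanishing.exists_obstruction_of_laurentIdentities hZ (fun j => (b j : ℂ)) j₀
      (by exact_mod_cast hb) W hWb 1 ξ I a κ q D₀ S₀ X D ha hκ hinj hi₀ hq hL
  have hcount := GenThreeVanishing.ncard_image_mk_zpowSet (m := m) 1 one_ne_zero ξ hind H r M hM
    hchars hdim X
  refine ⟨H, r, M, Summit.ABC.StewartYu.MatveevStepData.rank_le_of_linearIndependent_int_rows M hM,
    GenThreeVanishing.addDim_le_one H, hM, hchars, hdim, ?_⟩
  rw [hcount] at hineq
  exact hineq

/-- **The END with exits, `H` kept, for independent complex units** (the `ξ`-form of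
`GenThreeEndExits.exists_exits_rat`): EITHER exit A (`b ∉ span_ℚ(rows M)` with the `(r+1−d₀)` inequality)
OR exit B/C (`k•b = ∑ cᵢ Mᵢ`, `k ≠ 0`, with the `(r−d₀)` inequality).  Consumed by the 𝔑-threaded frames at
`ξⱼ = rpowUnit (αⱼ) _ (1/N)` (odd `p`) / `rpowUnit (αⱼ²) _ (1/N)` (`p = 2`).
[cite: Nesterenko2003, Prop 5.1 with Lemmas 5.2–5.3, (5.9)–(5.13)] -/
theorem exists_exits_units (hZ : Nesterenko2003_prop51)
    (ξ : Fin m → ℂˣ) (hind : ∀ φ : Fin m → ℤ, ∏ j, ξ j ^ φ j = 1 → φ = 0)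
    (b : Fin m → ℤ) (j₀ : Fin m) (hb : b j₀ ≠ 0)
    (W : Submodule ℂ (ℂ × (Fin m → ℂ))) (hW : ∀ w, w ∈ W ↔ ∑ j, (b j : ℂ) * w.2 j = 0)
    {ι : Type*} (I : Finset ι) (a : ι → ℕ) (κ : ι → Fin m → ℤ) (q : ι → ℂ)
    (D₀ S₀ X : ℕ) (D : Fin m → ℕ)
    (ha : ∀ i ∈ I, a i ≤ D₀) (hκ : ∀ i ∈ I, ∀ j, |κ i j| ≤ (D j : ℤ))
    (hinj : Set.InjOn (fun i => (a i, κ i)) I) {i₀ : ι} (hi₀ : i₀ ∈ I) (hq : q i₀ ≠ 0)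
    (hL : ∀ x : ℤ, |x| ≤ (((m + 1) * X : ℕ) : ℤ) → ∀ (t : ℕ) (ν : Fin m → ℕ), ν j₀ = 0 →
      t + ∑ k, ν k ≤ (m + 1) * S₀ →
      ∑ i ∈ I, q i * (((a i).descFactorial t : ℕ) : ℂ) * ((x : ℂ) * 1) ^ (a i - t) *
        (∏ k, ((b j₀ : ℂ) * (κ i k : ℂ) - (b k : ℂ) * (κ i j₀ : ℂ)) ^ ν k) *
        ∏ j, ((ξ j : ℂ)) ^ (x * κ i j) = 0) :
    ∃ (H : ConnAlgSubgroup m) (r : ℕ) (M : Matrix (Fin r) (Fin m) ℤ),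
      r ≤ m ∧ H.addDim ≤ 1 ∧
      LinearIndependent ℤ (fun i => M i) ∧
      H.chars = AddSubgroup.closure (Set.range fun i => M i) ∧
      (((¬ ∃ (k : ℤ) (c : Fin r → ℤ), k ≠ 0 ∧ k • b = ∑ i, c i • M i) ∧
          Nat.choose (S₀ + (r + 1 - H.addDim)) (r + 1 - H.addDim) * (2 * X + 1) *
              nesterenkoH m r H.addDim M D₀ D ≤ (m + 1).factorial * 2 ^ m * D₀ * ∏ j, D j) ∨
        ((∃ (k : ℤ) (c : Fin r → ℤ), k ≠ 0 ∧ k • b = ∑ i, c i • M i) ∧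
          Nat.choose (S₀ + (r - H.addDim)) (r - H.addDim) * (2 * X + 1) *
              nesterenkoH m r H.addDim M D₀ D ≤ (m + 1).factorial * 2 ^ m * D₀ * ∏ j, D j)) := by
  classical
  have hWb : ∀ u ∈ W, ∑ j, (b j : ℂ) * u.2 j = 0 := fun u hu => (hW u).mp hu
  obtain ⟨H, r, M, hr, hd, hM, hchars, _hdim, hineq⟩ :=
    exists_obstruction_units hZ ξ hind b j₀ hb W hWb I a κ q D₀ S₀ X D ha hκ hinj hi₀ hq hL
  have hb0 : b ≠ 0 := by
    intro h0; apply hb; rw [h0]; rfl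
  obtain ⟨hspan, hnspan⟩ := Summit.ABC.StewartYu.ZeroEnd.ell0_add_addDim_eq b hb0 W hW H M hM hchars
  refine ⟨H, r, M, hr, hd, hM, hchars, ?_⟩
  by_cases hex : ∃ (k : ℤ) (c : Fin r → ℤ), k ≠ 0 ∧ k • b = ∑ i, c i • M i
  · right
    refine ⟨hex, ?_⟩
    have hℓ : Module.finrank ℂ W - Module.finrank ℂ ↥(W ⊓ H.tangent) = r - H.addDim := by
      have h := hspan hex; omega
    rw [hℓ] at hineq
    exact hineq
  · left
    refine ⟨hex, ?_⟩
    have hℓ : Module.finrank ℂ W - Module.finrank ℂ ↥(W ⊓ H.tangent) = r + 1 - H.addDim := by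
      have h := hnspan hex; omega
    rw [hℓ] at hineq
    exact hineq

end Summit.ABC.StewartYu.GenThreeEndReal

end
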